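import Summits.CriticalPhenomena.PercolationContinuityZ3.Theorems.PercNearOneGluingNoHeavyQuantGappedForestCaps
import Summits.CriticalPhenomena.PercolationContinuityZ3.Theorems.PercNearOneGluingNoHeavyQuantDECTwoLow
import Summits.CriticalPhenomena.PercolationContinuityZ3.Theorems.PercNearOneGluingNoHeavyQuantResidDEC
import HarnessLib

/-!
# QUANT lane R8, T-DEC: THE GAPPED TRIPLE `(R¹[q](R³[s]))³` — part 3: RESID-DEC at every outer gate and SDEC at its floor `qs` for every
# `0 < q < 1`, `0 < s ≤ 3/5` (floors up to `.6`, in particular route 2's adverse instances `s = 3/5`, `q ∈ {.9,.95,.97,.99}`), by a certificate with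
# TWO paired low atoms (census-1 gen 24)

builds on p205010 (kernel theorem, internal audit signed; external expert review pending)

Support file (`--supports stmt-CriticalPhenomena-4575`), QUANT lane seat prim-quant-census-1 (gen 24); memo
`run/shared/lean/prim/quant/prim-quant-census-1/RESID-DEC-G24.md` §6.  Theorems only (no definitions, no `@[conjecture]`), standard axioms, no
sorries.  Sequel of `…QuantGappedForestLaws` / `…QuantGappedForestCaps` (law, closed-form residual, inequalities); uses this seat's `…QuantDECOneLow`
(`decAt_all_of_oneLow`) and `…QuantDECTwoLow` (`decAtT_all_of_twoLow`), arm-1 g49's `…QuantGluedForestSDEC` / `…QuantRootScaledHeavyRoots` (`gluedSib`,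
`decAt_resid_of_noLow`, `resid_eq_zero_below`) and typer g41's `…QuantResidDEC` (`ResidDECAt`, `sdec_flaw_of_residDECAt`; README V431).

THE CERTIFICATE (see part 1's header; `T = a·fmean = 3aq(1+3s)`, `y = a·x ≤ aqs`, `γ = max(y, (T−4)/7)`):
* `T ≤ 4`: no positive low atom (arm-1 g49's regime, `R = 1`);
* `4 < T ≤ 6`: the ONLY positive low atom is `2`; ONE-LOW PEELING onto the partner `9` (capacity `gapped_I3`/`gapped_I4`, torque `gapped_tor_two`);
* `6 < T (≤ 42/5)`: the low atoms are `2` AND `3`; **TWO-LOW PEELING** (`decAtT_all_of_twoLow`, `…QuantDECTwoLow`: low atoms `{0, lo₁, lo₂}`, one common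
  partner `P`, common gate `γ = max(y, (T − 2lo₁)/(P − lo₁))`, capacity `(μ lo₁ + μ lo₂)·γ ≤ μ P·(1−γ)`, both pair means `≤ T`) onto `9`
  (capacity `gapped_I5`/`gapped_I8`, torque `gapped_tor_two`/`gapped_tor_three`).
Hence **`residDECAt_gapped`** (`ResidDECAt x a L` for every `0 < a < 1`, floor `x ≤ q·(s·y')` recorded as in arm-1's files), **`sdec_gappedTriple`**:
`SDEC (qs) 12 (flaw [gluedSib 1 3 q s s]³)` for every `0 < q < 1`, `0 < s ≤ 3/5`, and the named instances `sdec_gappedTriple_90_60` (floor `27/50`,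
the lead's / census-2's natural-floor OUT of the caterpillar hull) and `sdec_gappedTriple_99_60` (floor `.594`).  HONEST: `s > 3/5` is not covered
here (the common-gate certificate's torque slack vanishes at `s = 3/5`, `T ↓ 4`; the census finds other certificates there).

* **`residDECAt_gapped`**, **`sdec_gappedTriple_lt`**, **`sdec_gappedTriple`**, `sdec_gappedTriple_90_60`,
  `sdec_gappedTriple_99_60`.

HONEST STATUS: an explicit SDEC family; `ResidDEC`, `SiblingStep`, `GateStepN`, `FarTreeRow` OPEN; RATE class log\* /
honest sentence of `run/shared/lean/prim/quant/README.md` unchanged.  [this work]; binder / heavy-roots regime: prim-quant-arm-1 g48/g49; node of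
record: prim-quant-lead g47 (V431) / prim-quant-stmt g41; the gapped family as route 2's adverse class: prim-quant-census-2 g74/g75, prim-quant-lead
g47.  Nothing here is cited as a published result.  The gluing rows served [cite: KozmaNitzan2024, Conjecture 3 (p. 15)]; product measure
[cite: Grimmett1999, §1.3 p. 10].
-/


noncomputable section

open scoped BigOperators

namespace Summit.CriticalPhenomena.PercolationContinuityZ3.Theorems
namespace Quant

open Finset

namespace LawDec

/-! ### The gapped triple: RESID-DEC at every outer gate -/

/-- **RESID-DEC AT EVERY OUTER GATE FOR THE GAPPED TRIPLE** `(R¹[q](R³[s]))³`, `0 < q < 1`, `0 < s ≤ 3/5`: recorded sub-forest floor `s·y'`,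
`0 < y' < 1`, floor `0 < x ≤ q·(s·y')`, `0 < a < 1` ⟹ `ResidDECAt x a L` (three regimes, see the file header). [this work] -/
theorem residDECAt_gapped {q s x y' a : ℝ} (hq0 : 0 < q) (hq1 : q < 1) (hs0 : 0 < s) (hs : s ≤ 3 / 5)
    (hx0 : 0 < x) (hy0 : 0 < y') (hy1 : y' < 1) (hxy : x ≤ q * (s * y')) (ha0 : 0 < a) (ha1 : a < 1) :
    ResidDECAt x a [gluedSib 1 3 q s (s * y'), gluedSib 1 3 q s (s * y'), gluedSib 1 3 q s (s * y')] := by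
  have hs1 : s < 1 := by linarith
  set g : Sib := gluedSib 1 3 q s (s * y') with hg
  set L : List Sib := [g, g, g] with hLdef
  have hqs0 : 0 < q * s := mul_pos hq0 hs0
  have hx : x < q * s := by nlinarith [mul_lt_mul_of_pos_left hy1 hqs0]
  have hx1 : x < 1 := by nlinarith
  have hT : g.TreeOK x := gluedSib_treeOK 1 3 le_rfl (by norm_num) hq0 hq1 hs0 hs1 hy0 hy1 hxy
  have hmem : ∀ t ∈ L, t = g := fun t ht => by
    simp only [hLdef, List.mem_cons, List.mem_nil_iff, or_false] at ht
    rcases ht with h | h | h <;> exact h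
  have hL : ∀ t ∈ L, t.TreeOK x := fun t ht => by rw [hmem t ht]; exact hT
  have hL' : ∀ t ∈ L, t.LawOK := fun t ht => (hL t ht).lawOK
  have hq : ∀ t ∈ L, t.q = q := fun t ht => by rw [hmem t ht, hg]; rfl
  have hR : ∀ t ∈ L, ∀ h, h < 1 → t.ρ h = 0 := fun t ht h hh => by
    rw [hmem t ht]
    exact gluedSib_rho_below 1 3 le_rfl (by norm_num) s h hh
  have htop : ftop L = 12 := by simp only [hLdef, ftop, hg]; rfl
  have hfmean : fmean L = 3 * (q * (1 + 3 * s)) := by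
    have e : fmean L = fmean (List.replicate 3 g) := by rw [hLdef]; rfl
    rw [e, fmean_replicate, hg, gluedSib_mean, show (gluedSib 1 3 q s (s * y')).q = q from rfl]
    push_cast
    ring
  have hw1 : wco a L < 1 := wco_lt_one ha1 g g [g] hL'
  have haq1 : a * q < 1 := by nlinarith
  have hD : 0 < 2 - q - a * q := by nlinarith
  have h1aq : 0 < 1 - a * q := by linarith
  have hE : 0 < (1 - a * q) + a * (1 - q) := by nlinarith
  have hax0 : 0 < a * x := mul_pos ha0 hx0
  have hax1 : a * x < 1 := by nlinarith
  have hy_le : a * x ≤ a * q * s := by nlinarith [mul_le_mul_of_nonneg_left hx.le ha0.le]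
  -- reduced variables: `u = aq`, `W = 3 + 9s`, `T = u·W = a·fmean`
  have hTW : a * fmean L = (a * q) * (3 + 9 * s) := by rw [hfmean]; ring
  have hT84 : a * fmean L ≤ 42 / 5 := by
    rw [hTW]
    have : (a * q) * (3 + 9 * s) ≤ 1 * (3 + 9 * s) := mul_le_mul_of_nonneg_right haq1.le (by linarith)
    linarith
  obtain ⟨r0, rM, r1, rmn⟩ := resid_laws ha0 ha1.le L hL' le_rfl hw1
  obtain ⟨hres0, hres2, hres3, hres9⟩ := resid_gapped q s (s * y') a hq0 hq1 ha1
  have hres4 := resid_gapped_four q s (s * y') a hq0 hq1 ha1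
  have hres1 : resid a (wco a L) L 1 = 0 := resid_eq_zero_below ha0 ha1.le 1 q L hL' hq hR 1 one_pos (by norm_num)
  -- atom `0` is charged
  have hpos0 : 0 < resid a (wco a L) L 0 := by
    rw [hLdef, hg, hres0]
    exact div_pos (mul_pos (by linarith) (pow_pos h1aq 2)) hD
  -- every charged atom other than `2`, `3` is `0` or `≥ 5`
  have hothers : ∀ h, 1 ≤ h → h ≠ 2 → h ≠ 3 → 0 < resid a (wco a L) L h → 10 ≤ 2 * (h : ℝ) := by
    intro h h1 h2 h3 hpos
    by_cases e1 : h = 1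
    · subst e1; exact absurd hres1 (ne_of_gt hpos)
    by_cases e4 : h = 4
    · subst e4; rw [hLdef, hg] at hpos; exact absurd hres4 (ne_of_gt hpos)
    have : (5 : ℝ) ≤ h := by exact_mod_cast (show 5 ≤ h by omega)
    linarith
  have hta : a * x * (ftop L : ℝ) ≤ a * fmean L := by
    rw [mul_assoc]; exact mul_le_mul_of_nonneg_left (ftop_mul_floor_le_fmean hx0 hx1 L hL) ha0.le
  intro j hj
  by_cases hreg : a * fmean L ≤ 4
  · -- no positive low atom (arm-1 g49)
    exact decAt_resid_of_noLow hx0 hx1 ha0 ha1.le 1 q L hL hq hR hw1 (by simpa using hreg) j hj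
  have hT4 : 4 < a * fmean L := lt_of_not_ge hreg
  have hT4u : 4 < (a * q) * (3 + 9 * s) := by rw [← hTW]; exact hT4
  have htor2 : 2 ≤ 3 * (a * q) + 2 * (a * q * s) := gapped_tor_two ha0 hq0 hs (by linarith)
  -- the common gate expression of both regimes
  have eγ : (a * fmean L - 2 * ((2 : ℕ) : ℝ)) / (((9 : ℕ) : ℝ) - ((2 : ℕ) : ℝ)) = ((a * q) * (3 + 9 * s) - 4) / 7 := by
    rw [hTW]; push_cast; ring
  by_cases hreg6 : a * fmean L ≤ 6
  · -- ONE positive low atom `2`, partner `9`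
    refine decAt_all_of_oneLow (a * x) (a * fmean L) (ftop L) 2 9 (resid a (wco a L) L) hax0 hax1 r0 rM r1 rmn hpos0
      (by norm_num) (by push_cast; linarith) (by norm_num) (by rw [htop]; norm_num) (by push_cast; linarith) ?_ hta ?_ ?_ j
    · intro h h1 h2 hpos
      by_cases e3 : h = 3
      · subst e3; push_cast; linarith
      · linarith [hothers h h1 h2 e3 hpos]
    · push_cast; rw [hTW]; linarith
    · rw [eγ, hLdef, hg, hres2, hres9]
      exact gapped_cap_one ha0 ha1 hq0 hq1 hs0 hs haq1 hax0 hax1 hy_le hT4u (by rw [← hTW]; exact hreg6)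
  · -- TWO positive low atoms `2`, `3`, common partner `9`
    have hT6 : 6 < a * fmean L := lt_of_not_ge hreg6
    have hT6u : 6 < (a * q) * (3 + 9 * s) := by rw [← hTW]; exact hT6
    have htor3 : 1 ≤ a * q + a * q * s := gapped_tor_three hs0 hs1.le (by linarith)
    have hd := decAtT_all_of_twoLow (a * x) (a * fmean L) (ftop L) 2 3 9 (resid a (wco a L) L) hax0 hax1 r0 rM r1 rmn hpos0
      (by norm_num) (by norm_num) (by push_cast; linarith) (by norm_num) (by rw [htop]; norm_num) (by push_cast; linarith)
      (fun h h1 h2 h3 hpos => by linarith [hothers h h1 h2 h3 hpos, hT84]) hta ?_ ?_ ?_ j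
    · rw [decAt_iff_decAtT, rmn]; exact hd
    · -- pair `{2, 9}` mean ≤ T
      rw [eγ]; push_cast
      rcases le_total (a * x) (((a * q) * (3 + 9 * s) - 4) / 7) with hle | hle
      · rw [max_eq_right hle, hTW]; linarith
      · rw [max_eq_left hle, hTW]; linarith
    · -- pair `{3, 9}` mean ≤ T
      rw [eγ]; push_cast
      rcases le_total (a * x) (((a * q) * (3 + 9 * s) - 4) / 7) with hle | hle
      · rw [max_eq_right hle, hTW]; linarith
      · rw [max_eq_left hle, hTW]; linarith
    · -- capacity of `9` for both
      rw [eγ, hLdef, hg, hres2, hres3, hres9]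
      exact gapped_cap_two ha0 ha1 hq0 hq1 hs0 hs haq1 hax0 hax1 hy_le hT6u

/-! ### SDEC of the gapped triple -/

/-- **THE GAPPED TRIPLE IS SDEC BELOW ITS LEAST MARGINAL**: `0 < q < 1`, `0 < s ≤ 3/5`, any floor `0 < x < qs`. [this work] -/
theorem sdec_gappedTriple_lt {q s : ℝ} (hq0 : 0 < q) (hq1 : q < 1) (hs0 : 0 < s) (hs : s ≤ 3 / 5)
    {x : ℝ} (hx0 : 0 < x) (hx : x < q * s) :
    SDEC x 12 (flaw [gluedSib 1 3 q s s, gluedSib 1 3 q s s, gluedSib 1 3 q s s]) := by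
  have hs1 : s < 1 := by linarith
  have hqs0 : 0 < q * s := mul_pos hq0 hs0
  have hqs1 : q * s < 1 := by nlinarith
  have hx1 : x < 1 := hx.trans hqs1
  set y : ℝ := x / (q * s) with hy
  have hy0 : 0 < y := div_pos hx0 hqs0
  have hy1 : y < 1 := (div_lt_one hqs0).2 hx
  have hxy : x ≤ q * (s * y) := by rw [hy, ← mul_assoc, mul_div_cancel₀ _ hqs0.ne']
  have hfl : flaw [gluedSib 1 3 q s s, gluedSib 1 3 q s s, gluedSib 1 3 q s s]
      = flaw [gluedSib 1 3 q s (s * y), gluedSib 1 3 q s (s * y), gluedSib 1 3 q s (s * y)] :=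
    flaw_replicate_gluedSib 3 1 3 q s s (s * y)
  set g : Sib := gluedSib 1 3 q s (s * y) with hg
  have hT : g.TreeOK x := gluedSib_treeOK 1 3 le_rfl (by norm_num) hq0 hq1 hs0 hs1 hy0 hy1 hxy
  have hL : ∀ t ∈ [g, g, g], t.TreeOK x := fun t ht => by
    simp only [List.mem_cons, List.mem_nil_iff, or_false] at ht
    rcases ht with h | h | h <;> rw [h] <;> exact hT
  have hρ : ∀ t ∈ [g, g, g], SDEC t.x₁ t.M t.ρ := fun t ht => by
    simp only [List.mem_cons, List.mem_nil_iff, or_false] at ht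
    have e : t = g := by rcases ht with h | h | h <;> exact h
    rw [e]
    show SDEC (s * y) (1 + 3) (slice (fun k : ℕ => if k = (1 : ℕ) then (1 : ℝ) else 0) 3 s)
    exact gluedSib_sdec 1 3 (mul_pos hs0 hy0) (by nlinarith) (by nlinarith) hs1.le
  have htop : ftop [g, g, g] = 12 := by simp only [ftop, hg]; rfl
  rw [hfl]
  have h := sdec_flaw_of_residDECAt hx0 hx1 [g, g, g] hL hρ (by simp)
    (fun a ha0 ha1 => residDECAt_gapped hq0 hq1 hs0 hs hx0 hy0 hy1 hxy ha0 ha1)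
  rw [htop] at h
  exact h

/-- **THE GAPPED TRIPLE `(R¹[q](R³[s]))³` IS SDEC AT ITS FLOOR `qs` FOR EVERY `0 < q < 1`, `0 < s ≤ 3/5`** — including the heavy floors
`qs ∈ [.54, .594]` of route 2's adverse instances (README V430/V431): the forest law on `{0..12}` is `SDEC (qs) 12`, the list form of
`SiblingStep` / the node `ResidDEC` on this family with the oracle discharged. [this work] -/
theorem sdec_gappedTriple {q s : ℝ} (hq0 : 0 < q) (hq1 : q < 1) (hs0 : 0 < s) (hs : s ≤ 3 / 5) :
    SDEC (q * s) 12 (flaw [gluedSib 1 3 q s s, gluedSib 1 3 q s s, gluedSib 1 3 q s s]) := by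
  have hs1 : s < 1 := by linarith
  have hqs0 : 0 < q * s := mul_pos hq0 hs0
  have hqs1 : q * s < 1 := by nlinarith
  have hL : ∀ t ∈ [gluedSib 1 3 q s s, gluedSib 1 3 q s s, gluedSib 1 3 q s s], t.LawOK := fun t ht => by
    simp only [List.mem_cons, List.mem_nil_iff, or_false] at ht
    have e : t = gluedSib 1 3 q s s := by rcases ht with h | h | h <;> exact h
    rw [e]
    obtain ⟨_, _, ρ0, ρM, ρ1, _⟩ := (gluedSib_treeBuiltN 1 3 hs0 hs1 (by norm_num : (0 : ℝ) < 1 / 2) (by norm_num)).lawFacts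
    exact ⟨hq0, hq1, ρ0, ρM, ρ1⟩
  obtain ⟨_, fM, _, _⟩ := flaw_facts _ hL
  have htop : ftop [gluedSib 1 3 q s s, gluedSib 1 3 q s s, gluedSib 1 3 q s s] = 12 := by simp only [ftop]; rfl
  rw [htop] at fM
  exact sdec_of_forall_lt hqs0 hqs1 fM (fun x hx0 hx => sdec_gappedTriple_lt hq0 hq1 hs0 hs hx0 hx)

/-- **`(R¹[9/10](R³[3/5]))³` IS `SDEC (27/50) 12`** — the lead's / census-2's natural-floor OUT instance of the caterpillar hull (floor `.54`).
[this work] -/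
theorem sdec_gappedTriple_90_60 :
    SDEC ((9 / 10 : ℝ) * (3 / 5)) 12
      (flaw [gluedSib 1 3 (9 / 10) (3 / 5) (3 / 5), gluedSib 1 3 (9 / 10) (3 / 5) (3 / 5), gluedSib 1 3 (9 / 10) (3 / 5) (3 / 5)]) :=
  sdec_gappedTriple (by norm_num) (by norm_num) (by norm_num) (by norm_num)

/-- **`(R¹[99/100](R³[3/5]))³` IS `SDEC (297/500) 12`** (floor `.594`, the heaviest of route 2's adverse instances). [this work] -/
theorem sdec_gappedTriple_99_60 :
    SDEC ((99 / 100 : ℝ) * (3 / 5)) 12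
      (flaw [gluedSib 1 3 (99 / 100) (3 / 5) (3 / 5), gluedSib 1 3 (99 / 100) (3 / 5) (3 / 5), gluedSib 1 3 (99 / 100) (3 / 5) (3 / 5)]) :=
  sdec_gappedTriple (by norm_num) (by norm_num) (by norm_num) (by norm_num)

end LawDec
end Quant
end Summit.CriticalPhenomena.PercolationContinuityZ3.Theorems
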